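import Literature.Computability.Complexity.Rossman2008
import HarnessLib

/-!
# Rossman 2008, Theorem 1.1 as printed is false for `t < 3/4`: a one-gate counterexample

B. Rossman, *On the constant-depth complexity of k-clique*, STOC 2008 [Rossman2008], Thm. 1.1
(§1.1) reads: "Suppose `f_n : {0,1}^{C(n,2)} → {0,1}` is a sequence of functions computed by
constant-depth circuits of size `O(n^t)` where `t > 1/2`. For any constants `k ∈ ℕ` and
`0 < α ≤ 1/(2t-1)`, let `G = ER(n, n^{-α})` … and let `A` be a uniform random set of `k` vertices
of `G`. Then `f_n(G) = f_n(G ∪ K_A)` asymptotically almost surely."  Size is "the number of gates"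
and gates have "unrestricted fan-in" (§2, Circuits; the same conventions as `Circuit.size` and
`acBasis`, and as Rossman's later papers, e.g. ECCC TR16-206 §4.1: "We measure size by the number
of gates").  The named fact `rossman2008_thm11` of `Rossman2008.lean` transcribes the sentence
verbatim — and it is false:

**Counterexample (the corner `1/2 < t < 3/4`, `2 ≤ α ≤ 1/(2t-1)`).** For `α > 2` the random
graph `ER(n, n^{-α})` has no edge at all with probability `(1 - n^{-α})^{C(n,2)} ≥ 1 - n^{2-α} → 1`,
while `G ∪ K_A` always has one (`k ≥ 2`); the single unbounded fan-in gate `⋁ₑ xₑ` ("is there an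
edge?") has depth `1` and size `1 = O(n^t)` for every `t > 0` and tells the two apart. This file
certifies the instance `k = 2`, `d = 1`, `t = 3/5`, `α = 3 ≤ 5 = 1/(2t-1)`, `c₀ = 1`,
`C_n =` the one-gate circuit of `exists_orGate_circuit`: `Pr[f_n(G) ≠ f_n(G ∪ K_A)] =
(1 - n^{-3})^{C(n,2)} ≥ 1 - 1/n ≥ 1/2` for all `n ≥ 2` (`plantFlipProb_anyEdge`,
`half_le_plantFlipProb_anyEdge`), hence `not_rossman2008_thm11 : ¬ rossman2008_thm11` (so every `h : rossman2008_thm11` proves `False`, and the in-file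
corollaries `rossman2008_thm11_uniform/threshold` are vacuous as stated).

**What the printed proof actually uses** (§5, "Proof of Theorem 1.1"): (i) its first displayed
inequality `max(α - 2, α·C(s,2) - s) < 0` (Cor. 3.9(1), `Pr[T_{⟨s⟩}(A) ≠ ∅] → 0`) forces
`α < 2`, i.e. `t > 3/4` — exactly excluding the corner above; (ii) the Circuit Lemma 3.6 is
invoked with `s = ⌈2t-1⌉`, but its base case ("`T•(ν) = e` if `e ⊆ A`, since `s ≥ 1`") needs
`s ≥ 2`, and "`α = 1/(2t-1) ≤ 1/s`" needs `s ≤ 2t - 1`; (iii) "without loss of generality all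
nodes have fan-in `n^β` … without even doubling its size" (proof of Thm. 3.10, reused in §5) is a
wire-count statement: with size = number of gates a single gate may read all `C(n,2)` inputs (as
the one-gate circuit here does) and the fan-in reduction costs `≈ #wires / n^β` new gates.  The paper's application,
Thm. 1.2 (`t = k/4`, `k ≥ 4`, `α = 2/(k-2) ≤ 1`), and Amano's restatement (Comput. Complexity 19
(2010), Thm. 1) live in `t ≥ 1`, `α ≤ 1`.  A corrected named fact must restrict `(t, α)` (and
settle (iii)) from the full version / the thesis (B. Rossman, *Average-case complexity of
detecting cliques*, MIT 2010); this file does not choose the correction, it only certifies that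
the range printed in [Rossman2008, Thm. 1.1] — hence `rossman2008_thm11` — cannot be used as is.

## References

* [Rossman2008] B. Rossman, On the constant-depth complexity of k-clique, STOC 2008, 721–730,
  doi:10.1145/1374376.1374480 — Thm. 1.1 (§1.1); §2 (Circuits: size = number of gates,
  unrestricted fan-in); §5, proof of Thm. 1.1, first display (`α < 2`); Lemma 3.6 (§3.2);
  proof of Thm. 3.10 (fan-in `n^β` reduction).
* B. Rossman, An improved homomorphism preservation theorem from lower bounds in circuit
  complexity, ECCC TR16-206 (2016), §4.1 (size = number of gates, unbounded fan-in).
-/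

noncomputable section

namespace Literature.Computability.Complexity

open Finset Filter
open scoped _root_.Topology

/-! ### The one-gate circuit `⋁ᵢ xᵢ` -/

/-- **One unbounded fan-in `∨`-gate reading every input** (in the order of `Fintype.equivFin`):
a circuit over `acBasis` with one gate, `acDepth ≤ 1`, computing `x ↦ [∃ i, x i]` — over the edge
variables of `K_n`, the graph property "has at least one edge". Stated as an existence theorem
(this file introduces no definitions). [folklore] -/
theorem exists_orGate_circuit (ι : Type*) [Fintype ι] [DecidableEq ι] :
    ∃ C : Circuit ι, C.size = 1 ∧ C.IsOver acBasis ∧ C.acDepth ≤ 1 ∧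
      ∀ x, C.eval x = decide (∃ i, x i = true) := by
  let C : Circuit ι :=
    { gates := [⟨Fintype.card ι, fun v => decide (∃ i, v i = true),
        fun a => .inl ((Fintype.equivFin ι).symm a)⟩]
      output := .inr 0
      wf := fun j h a m hm => by
        simp only [List.length_singleton, Nat.lt_one_iff] at h
        subst h
        simp at hm
      wf_output := fun m h => by cases h; simp }
  refine ⟨C, rfl, ?_, ?_, ?_⟩
  · intro g hg
    simp only [C, List.mem_singleton] at hg
    subst hg
    exact or_mem_acBasis (Fintype.card ι)
  · simp only [Circuit.acDepth, Circuit.depthWith, Circuit.depthVals, C, List.foldl_cons,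
      List.foldl_nil, List.nil_append, List.getD_cons_zero]
    refine Nat.add_le_of_le_sub' (by unfold acWeight; split <;> simp) ?_
    exact (Finset.sup_le fun a _ => le_rfl).trans (Nat.zero_le _)
  · intro x
    have h : C.eval x = decide (∃ a : Fin (Fintype.card ι),
        x ((Fintype.equivFin ι).symm a) = true) := rfl
    rw [h, decide_eq_decide]
    exact ((Fintype.equivFin ι).symm.surjective.exists (p := fun i => x i = true)).symm

/-! ### The flip probability of "has an edge" under a planted edge -/

variable {n : ℕ}

/-- Planting a clique on a set with two (distinct) vertices switches an edge on. [folklore] -/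
theorem exists_plantClique_eq_true_of_card_eq_two {A : Finset (Fin n)} (hA : #A = 2)
    (x : (⊤ : SimpleGraph (Fin n)).edgeSet → Bool) : ∃ e, plantClique A x e = true := by
  obtain ⟨u, v, huv, rfl⟩ := Finset.card_eq_two.1 hA
  have he : s(u, v) ∈ (⊤ : SimpleGraph (Fin n)).edgeSet := by simpa using huv
  refine ⟨⟨s(u, v), he⟩, ?_⟩
  have hc : cliqueVec {u, v} ⟨s(u, v), he⟩ = true := by
    simp [cliqueVec]
  simp [plantClique, hc]

/-- The empty graph has no edge switched on: `e(⊥) = 0`. [folklore] -/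
theorem edgeCount_false : edgeCount (fun _ : (⊤ : SimpleGraph (Fin n)).edgeSet => false) = 0 := by
  simp [edgeCount]

/-- For a two-element `A`, the `G(n,q)`-mass of the edge vectors on which planting `K_A` flips
"has an edge" is exactly the mass `(1-q)^{C(n,2)}` of the empty graph. [folklore] -/
theorem sum_flip_anyEdge {A : Finset (Fin n)} (hA : #A = 2) (q : ℝ) :
    (∑ x : (⊤ : SimpleGraph (Fin n)).edgeSet → Bool,
        if decide (∃ e, x e = true) = decide (∃ e, plantClique A x e = true) then 0
        else gnpWeight n q x) =
      (1 - q) ^ (n.choose 2) := by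
  rw [Finset.sum_eq_single (fun _ => false)]
  · have h0 : decide (∃ _e : (⊤ : SimpleGraph (Fin n)).edgeSet, false = true) = false := by simp
    have h1 : decide (∃ e, plantClique A (fun _ => false) e = true) = true :=
      decide_eq_true (exists_plantClique_eq_true_of_card_eq_two hA _)
    rw [h0, h1]
    simp [gnpWeight, edgeCount_false]
  · intro x _ hx
    have hx' : decide (∃ e, x e = true) = true := by
      simp only [decide_eq_true_eq]
      by_contra hne
      push Not at hne
      exact hx (funext fun e => by simpa using hne e)
    rw [hx', decide_eq_true (exists_plantClique_eq_true_of_card_eq_two hA x)]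
    simp
  · intro h
    exact absurd (Finset.mem_univ _) h

/-- **The flip probability of `⋁ₑ xₑ` under a planted edge** (`k = 2`): for `n ≥ 2`,
`Pr_{G ∼ G(n,q), A}[[G ≠ ∅] ≠ [G ∪ K_A ≠ ∅]] = (1 - q)^{C(n,2)}` — the probability that `G` is
empty. [folklore] -/
theorem plantFlipProb_anyEdge (hn : 2 ≤ n) (q : ℝ) :
    plantFlipProb n 2 q (fun x => decide (∃ e, x e = true)) = (1 - q) ^ (n.choose 2) := by
  simp only [plantFlipProb]
  have hsum : ∀ A ∈ powersetCard 2 (univ : Finset (Fin n)),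
      (∑ x : (⊤ : SimpleGraph (Fin n)).edgeSet → Bool,
        if decide (∃ e, x e = true) = decide (∃ e, plantClique A x e = true) then 0
        else gnpWeight n q x) =
      (1 - q) ^ (n.choose 2) := fun A hA =>
    sum_flip_anyEdge (Finset.mem_powersetCard.1 hA).2 q
  rw [Finset.sum_congr rfl hsum, Finset.sum_const, Finset.card_powersetCard, Finset.card_univ,
    Fintype.card_fin, nsmul_eq_mul]
  have hc : ((n.choose 2 : ℕ) : ℝ) ≠ 0 := by
    have : 0 < n.choose 2 := Nat.choose_pos hn
    exact_mod_cast this.ne'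
  rw [inv_mul_cancel_left₀ hc]

/-- Bernoulli: for `n ≥ 2`, `(1 - n^{-3})^{C(n,2)} ≥ 1 - C(n,2) n^{-3} ≥ 1 - 1/n ≥ 1/2`.
[folklore] -/
theorem half_le_plantFlipProb_anyEdge (hn : 2 ≤ n) :
    (1 : ℝ) / 2 ≤ plantFlipProb n 2 ((n : ℝ) ^ (-(3 : ℝ))) (fun x => decide (∃ e, x e = true)) := by
  rw [plantFlipProb_anyEdge hn]
  have hn0 : (0 : ℝ) < n := by exact_mod_cast (show 0 < n by omega)
  have hn2 : (2 : ℝ) ≤ n := by exact_mod_cast hn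
  have hq : (n : ℝ) ^ (-(3 : ℝ)) = ((n : ℝ) ^ 3)⁻¹ := by
    rw [Real.rpow_neg hn0.le, show (3 : ℝ) = ((3 : ℕ) : ℝ) by norm_num, Real.rpow_natCast]
  rw [hq]
  set q : ℝ := ((n : ℝ) ^ 3)⁻¹ with hq_def
  have hq0 : 0 ≤ q := by positivity
  have hq1 : q ≤ 1 := by
    rw [hq_def]
    exact inv_le_one_of_one_le₀ (one_le_pow₀ (by linarith))
  -- Bernoulli's inequality
  have hB : 1 + (n.choose 2 : ℕ) * (-q) ≤ (1 + (-q)) ^ (n.choose 2) :=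
    one_add_mul_le_pow (by linarith) _
  have hchoose : ((n.choose 2 : ℕ) : ℝ) ≤ (n : ℝ) ^ 2 := by
    exact_mod_cast Nat.choose_le_pow n 2
  have hmain : ((n.choose 2 : ℕ) : ℝ) * q ≤ 1 / 2 := by
    calc ((n.choose 2 : ℕ) : ℝ) * q ≤ (n : ℝ) ^ 2 * q :=
          mul_le_mul_of_nonneg_right hchoose hq0
      _ = (n : ℝ)⁻¹ := by
          rw [hq_def]; field_simp
      _ ≤ 1 / 2 := by rw [inv_le_comm₀ hn0 (by norm_num)]; simpa using hn2
  calc (1 : ℝ) / 2 ≤ 1 + (n.choose 2 : ℕ) * (-q) := by linarith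
    _ ≤ (1 + (-q)) ^ (n.choose 2) := hB
    _ = (1 - q) ^ (n.choose 2) := by rw [← sub_eq_add_neg]

/-! ### The refutation -/

/-- **`rossman2008_thm11` is false** (so [Rossman2008, Thm. 1.1] is false as printed in the
corner `t < 3/4`, `α ≥ 2`, with size = number of gates and unrestricted fan-in as in its §2):
with `k = 2`, `d = 1`, `t = 3/5`, `α = 3 ≤ 1/(2t-1) = 5`, `c₀ = 1` and the one-gate circuits
`⋁ₑ xₑ` (depth `1`, size `1 ≤ n^{3/5}`), the flip probability is `(1 - n^{-3})^{C(n,2)} ≥ 1/2`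
for every `n ≥ 2`, so it does not tend to `0`.
[cite: Rossman2008, Thm. 1.1 (§1.1); §5, proof of Thm. 1.1, first display (needs `α < 2`)] -/
theorem not_rossman2008_thm11 : ¬ rossman2008_thm11 := by
  intro h
  have ht : (1 : ℝ) / 2 < 3 / 5 := by norm_num
  have hα : (0 : ℝ) < 3 := by norm_num
  have hαt : (3 : ℝ) ≤ 1 / (2 * (3 / 5) - 1) := by norm_num
  choose C hCsize hCover hCdepth hCeval using
    fun n : ℕ => exists_orGate_circuit ((⊤ : SimpleGraph (Fin n)).edgeSet)
  have hC : ∀ᶠ n : ℕ in atTop, (C n).IsOver acBasis ∧ (C n).acDepth ≤ 1 ∧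
      ((C n).size : ℝ) ≤ 1 * (n : ℝ) ^ ((3 : ℝ) / 5) := by
    filter_upwards [eventually_ge_atTop 1] with n hn
    refine ⟨hCover n, hCdepth n, ?_⟩
    rw [hCsize n, Nat.cast_one, one_mul]
    exact Real.one_le_rpow (by exact_mod_cast hn) (by norm_num)
  have hlim := h 2 1 (3 / 5) 3 1 ht hα hαt C hC
  have hev : ∀ᶠ n : ℕ in atTop,
      plantFlipProb n 2 ((n : ℝ) ^ (-(3 : ℝ))) (C n).eval < 1 / 2 :=
    (tendsto_order.1 hlim).2 _ (by norm_num)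
  obtain ⟨n, hn, hn2⟩ := (hev.and (eventually_ge_atTop 2)).exists
  rw [plantFlipProb_congr (hCeval n)] at hn
  exact (lt_irrefl _) ((half_le_plantFlipProb_anyEdge hn2).trans_lt hn)

end Literature.Computability.Complexity

end
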